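import Summits.QuantumFields.YangMills.Theorems.BalabanLadderNTWeakPackageCoverThreePointSeq
import Summits.QuantumFields.YangMills.Theorems.BalabanLadderNTWeakPackageCover
import Summits.QuantumFields.YangMills.Theorems.BalabanLadderNTWeakPackageOfFloor
import HarnessLib

/-!
# Crux `NT` (stmt-QuantumFields-19353), stub `stub_cfpw : CFPW`: `NT` BY NAME from the GEOMETRIC femto package

Helper file (`--supports stmt-QuantumFields-19353`) of the fleet lead prover of crux `NT` (unit `ym-spine-19353-p1`,
g3).  Kernel-checked form of the g3 reductions (`…BoundaryLawOscillation`, `…WeakPackageCover`,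
`…WeakPackageCoverThreePoint[Seq]`): the registered composition `NT_of := WeakPackage.nt_of_weakPackage stub_cfpw`
(skeleton v3 «weak-package», 374f16092bb0c203) is fed by a package stated ENTIRELY on the engine's own geometric
sequence of cube sizes `R_k` (`R_{k+1} + 1 ≤ θ (R_k + 1)`, unbounded — e.g. `L^k M`):

* (E1-osc) the exterior-to-exterior oscillation of the central kernel mean of the action density on the centred femto
  cubes `[-R_k, R_k]⁴` is at most `C₁/(R_k+1)⁴` (no reference value);
* (E2′) the conditional two-point floor in the forward cone on the x-centred femto cubes of radii `R_k`, antitone collar,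
  shape `Γ` positive and monotone on `(0, ℓ₂]` with `Γ(s)/s⁸ → ∞`;
* (E3) the signed conditional third-cumulant floor at one reference triangle on the x-centred femto cubes of radii `R_k`,
  antitone collar, shape `Γ₃` positive and monotone on `(0, ℓ₃]` with `Γ₃(s)/s⁴ → ∞`.

`lowerBounds_of_geometricPackage`: these, for ONE `(G, r, a)` with `0 < a → 0`, give `LowerBounds G r a`
(`fbl_of_oscillation_seq` → `FBL`; `floorClause_of_seq` → (F); `fc3Weak_of_seq` → (T); `lowerBounds_of_floorPackage`).
`nt_of_geometricPackage`: the existence form over every compact simple `G` gives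
`Summit.QuantumFields.YangMills.Theses.BalabanLadder.NT` BY NAME.  Nothing here is engine content; the three displayed
statements are what remains (XL, unprinted: Bałaban 1989 CMP 122 p. 356 announces the observable-level analysis).
-/

set_option autoImplicit false

noncomputable section

open MeasureTheory Filter Topology
open Literature.MathematicalPhysics.QuantumFieldTheory Literature.MathematicalPhysics.QuantumLattice
open Literature.Probability.LatticeModels
open Summit.QuantumFields.YangMills.Cruxes.OSLegsFromFemtoAndGap.DlrCollarTransfer
open Summit.QuantumFields.YangMills.Cruxes.NT.BoundaryLaw (fbl_of_oscillation_seq)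

namespace Summit.QuantumFields.YangMills.Cruxes.NT.WeakPackage

section Lattice

variable (G : Type) [Group G] [TopologicalSpace G] [IsTopologicalGroup G] [CompactSpace G]
  [MeasurableSpace G] [BorelSpace G] (r : LatticeRep G) (a : ℝ → ℝ)

/-- **`LowerBounds` from the geometric femto package.**  For a unit map `0 < a → 0` and an unbounded sequence of radii
`R_k` with `R_{k+1} + 1 ≤ θ (R_k + 1)` (`θ ≥ 1`): the oscillation bound (E1-osc), the two-point floor (E2′) and the
signed third-cumulant floor (E3), each on the cubes of radii `R_k` only, give the `k`-free lattice lower bounds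
`LowerBounds G r a`. [folklore] -/
theorem lowerBounds_of_geometricPackage (hapos : ∀ β, 0 < a β) (hlim : Tendsto a atTop (𝓝 0))
    (Rs : ℕ → ℕ) (θ : ℝ) (hθ : 1 ≤ θ) (hgap : ∀ k, (Rs (k + 1) : ℝ) + 1 ≤ θ * ((Rs k : ℝ) + 1))
    (hunb : ∀ R : ℕ, ∃ k, R < Rs k)
    (hE1 : ∃ (C₁ β₁ ℓ₁ : ℝ), 0 < ℓ₁ ∧ ∀ β : ℝ, β₁ ≤ β → ∀ k : ℕ,
      ((2 * Rs k + 1 : ℕ) : ℝ) * a β ≤ ℓ₁ → ∀ η η' : LGConfig 4 G,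
        |kerE G r β (fun _ => -(Rs k : ℤ)) (2 * Rs k + 1) η (dens G r 0) -
          kerE G r β (fun _ => -(Rs k : ℤ)) (2 * Rs k + 1) η' (dens G r 0)| ≤ C₁ / ((Rs k : ℝ) + 1) ^ 4)
    (hE2 : ∃ (Γ : ℝ → ℝ) (β₂ ℓ₂ c₂ : ℝ) (K : ℝ → ℝ) (n₀ : ℕ), 0 < ℓ₂ ∧ 0 < c₂ ∧ (∀ s, 1 ≤ K s) ∧
      AntitoneOn K (Set.Ioi 0) ∧ Tendsto (fun s : ℝ => s * K s) (nhdsWithin 0 (Set.Ioi 0)) (nhds 0) ∧ 1 ≤ n₀ ∧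
      Tendsto (fun s : ℝ => Γ s / s ^ 8) (nhdsWithin 0 (Set.Ioi 0)) atTop ∧
      (∀ s : ℝ, 0 < s → s ≤ ℓ₂ → 0 < Γ s) ∧ MonotoneOn Γ (Set.Ioc 0 ℓ₂) ∧
      ∀ β : ℝ, β₂ ≤ β → ∀ (x : Fin 4 → ℤ) (k : ℕ), ((2 * Rs k + 1 : ℕ) : ℝ) * a β ≤ ℓ₂ →
        ∀ (η : LGConfig 4 G) (y : Fin 4 → ℤ), 0 < ‖siteToE (y - x)‖ * a β →
          (n₀ : ℝ) ≤ ‖siteToE (y - x)‖ → ‖siteToE (y - x)‖ < 3 * siteToE (y - x) 0 →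
            K (‖siteToE (y - x)‖ * a β) * ‖siteToE (y - x)‖ ≤ depth (fun j => x j - Rs k) (2 * Rs k + 1) y →
              c₂ * Γ (‖siteToE (y - x)‖ * a β) ≤
                ‖siteToE (y - x)‖ ^ 8 *
                  kerCov G r β (fun j => x j - Rs k) (2 * Rs k + 1) η (dens G r x) (dens G r y))
    (hE3 : ∃ (v w : EuclideanSpace ℝ (Fin 4)) (σ δ : ℝ) (Γ₃ : ℝ → ℝ) (β₃ ℓ₃ c₃ : ℝ) (K₃ : ℝ → ℝ) (n₃ : ℕ),
      (σ = 1 ∨ σ = -1) ∧ 0 < δ ∧ 2 * δ < ‖v‖ ∧ 2 * δ < ‖w‖ ∧ 2 * δ < ‖v - w‖ ∧ 0 < ℓ₃ ∧ 0 < c₃ ∧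
      (∀ s, 1 ≤ K₃ s) ∧ AntitoneOn K₃ (Set.Ioi 0) ∧
      Tendsto (fun s : ℝ => s * K₃ s) (nhdsWithin 0 (Set.Ioi 0)) (nhds 0) ∧
      Tendsto (fun s : ℝ => Γ₃ s / s ^ 4) (nhdsWithin 0 (Set.Ioi 0)) atTop ∧
      (∀ s : ℝ, 0 < s → s ≤ ℓ₃ → 0 < Γ₃ s) ∧ MonotoneOn Γ₃ (Set.Ioc 0 ℓ₃) ∧
      ∀ β : ℝ, β₃ ≤ β → ∀ (x : Fin 4 → ℤ) (k : ℕ), ((2 * Rs k + 1 : ℕ) : ℝ) * a β ≤ ℓ₃ →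
        ∀ (η : LGConfig 4 G) (n : ℕ) (y z : Fin 4 → ℤ), 0 < (n : ℝ) * a β →
          n₃ ≤ n → ‖siteToE (y - x) - (n : ℝ) • v‖ ≤ δ * n → ‖siteToE (z - x) - (n : ℝ) • w‖ ≤ δ * n →
            K₃ ((n : ℝ) * a β) * n ≤ depth (fun j => x j - Rs k) (2 * Rs k + 1) x →
            K₃ ((n : ℝ) * a β) * n ≤ depth (fun j => x j - Rs k) (2 * Rs k + 1) y →
            K₃ ((n : ℝ) * a β) * n ≤ depth (fun j => x j - Rs k) (2 * Rs k + 1) z →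
              c₃ * Γ₃ ((n : ℝ) * a β) ≤
                σ * (n : ℝ) ^ 12 * kerK3 G r β (fun j => x j - Rs k) (2 * Rs k + 1) η x y z) :
    LowerBounds G r a := by
  have hFBL : FBL G r a := fbl_of_oscillation_seq G r a hapos Rs θ hgap hunb hE1
  exact lowerBounds_of_floorPackage G r a hapos hlim hFBL (floorClause_of_seq G r a hapos hFBL Rs θ hθ hgap hunb hE2)
    (fc3Weak_of_seq G r a hapos hFBL Rs θ hθ hgap hunb hE3)

end Lattice

/-- **Crux `NT` BY NAME from the geometric femto package.**  If for every compact simple `G` (Borel σ-algebra) some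
lattice representation `r`, unit map `a` (`0 < a`, `a → 0`) and geometric sequence of radii `R_k` (`R_{k+1}+1 ≤ θ(R_k+1)`,
`θ ≥ 1`, unbounded) carry (E1-osc), (E2′) and (E3) on the cubes of radii `R_k`, then
`Summit.QuantumFields.YangMills.Theses.BalabanLadder.NT`. [folklore] -/
theorem nt_of_geometricPackage
    (h : ∀ (G : Type) [Group G] [TopologicalSpace G] [IsTopologicalGroup G] [CompactSpace G],
      IsCompactSimpleLieGroup G → letI : MeasurableSpace G := borel G; haveI : BorelSpace G := ⟨rfl⟩;
      ∃ (r : LatticeRep G) (a : ℝ → ℝ) (Rs : ℕ → ℕ) (θ : ℝ), (∀ β, 0 < a β) ∧ Tendsto a atTop (𝓝 0) ∧ 1 ≤ θ ∧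
      (∀ k, (Rs (k + 1) : ℝ) + 1 ≤ θ * ((Rs k : ℝ) + 1)) ∧ (∀ R : ℕ, ∃ k, R < Rs k) ∧
      (∃ (C₁ β₁ ℓ₁ : ℝ), 0 < ℓ₁ ∧ ∀ β : ℝ, β₁ ≤ β → ∀ k : ℕ,
        ((2 * Rs k + 1 : ℕ) : ℝ) * a β ≤ ℓ₁ → ∀ η η' : LGConfig 4 G,
          |kerE G r β (fun _ => -(Rs k : ℤ)) (2 * Rs k + 1) η (dens G r 0) -
            kerE G r β (fun _ => -(Rs k : ℤ)) (2 * Rs k + 1) η' (dens G r 0)| ≤ C₁ / ((Rs k : ℝ) + 1) ^ 4) ∧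
      (∃ (Γ : ℝ → ℝ) (β₂ ℓ₂ c₂ : ℝ) (K : ℝ → ℝ) (n₀ : ℕ), 0 < ℓ₂ ∧ 0 < c₂ ∧ (∀ s, 1 ≤ K s) ∧
        AntitoneOn K (Set.Ioi 0) ∧ Tendsto (fun s : ℝ => s * K s) (nhdsWithin 0 (Set.Ioi 0)) (nhds 0) ∧ 1 ≤ n₀ ∧
        Tendsto (fun s : ℝ => Γ s / s ^ 8) (nhdsWithin 0 (Set.Ioi 0)) atTop ∧
        (∀ s : ℝ, 0 < s → s ≤ ℓ₂ → 0 < Γ s) ∧ MonotoneOn Γ (Set.Ioc 0 ℓ₂) ∧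
        ∀ β : ℝ, β₂ ≤ β → ∀ (x : Fin 4 → ℤ) (k : ℕ), ((2 * Rs k + 1 : ℕ) : ℝ) * a β ≤ ℓ₂ →
          ∀ (η : LGConfig 4 G) (y : Fin 4 → ℤ), 0 < ‖siteToE (y - x)‖ * a β →
            (n₀ : ℝ) ≤ ‖siteToE (y - x)‖ → ‖siteToE (y - x)‖ < 3 * siteToE (y - x) 0 →
              K (‖siteToE (y - x)‖ * a β) * ‖siteToE (y - x)‖ ≤ depth (fun j => x j - Rs k) (2 * Rs k + 1) y →
                c₂ * Γ (‖siteToE (y - x)‖ * a β) ≤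
                  ‖siteToE (y - x)‖ ^ 8 *
                    kerCov G r β (fun j => x j - Rs k) (2 * Rs k + 1) η (dens G r x) (dens G r y)) ∧
      (∃ (v w : EuclideanSpace ℝ (Fin 4)) (σ δ : ℝ) (Γ₃ : ℝ → ℝ) (β₃ ℓ₃ c₃ : ℝ) (K₃ : ℝ → ℝ) (n₃ : ℕ),
        (σ = 1 ∨ σ = -1) ∧ 0 < δ ∧ 2 * δ < ‖v‖ ∧ 2 * δ < ‖w‖ ∧ 2 * δ < ‖v - w‖ ∧ 0 < ℓ₃ ∧ 0 < c₃ ∧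
        (∀ s, 1 ≤ K₃ s) ∧ AntitoneOn K₃ (Set.Ioi 0) ∧
        Tendsto (fun s : ℝ => s * K₃ s) (nhdsWithin 0 (Set.Ioi 0)) (nhds 0) ∧
        Tendsto (fun s : ℝ => Γ₃ s / s ^ 4) (nhdsWithin 0 (Set.Ioi 0)) atTop ∧
        (∀ s : ℝ, 0 < s → s ≤ ℓ₃ → 0 < Γ₃ s) ∧ MonotoneOn Γ₃ (Set.Ioc 0 ℓ₃) ∧
        ∀ β : ℝ, β₃ ≤ β → ∀ (x : Fin 4 → ℤ) (k : ℕ), ((2 * Rs k + 1 : ℕ) : ℝ) * a β ≤ ℓ₃ →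
          ∀ (η : LGConfig 4 G) (n : ℕ) (y z : Fin 4 → ℤ), 0 < (n : ℝ) * a β →
            n₃ ≤ n → ‖siteToE (y - x) - (n : ℝ) • v‖ ≤ δ * n → ‖siteToE (z - x) - (n : ℝ) • w‖ ≤ δ * n →
              K₃ ((n : ℝ) * a β) * n ≤ depth (fun j => x j - Rs k) (2 * Rs k + 1) x →
              K₃ ((n : ℝ) * a β) * n ≤ depth (fun j => x j - Rs k) (2 * Rs k + 1) y →
              K₃ ((n : ℝ) * a β) * n ≤ depth (fun j => x j - Rs k) (2 * Rs k + 1) z →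
                c₃ * Γ₃ ((n : ℝ) * a β) ≤
                  σ * (n : ℝ) ^ 12 * kerK3 G r β (fun j => x j - Rs k) (2 * Rs k + 1) η x y z)) :
    Summit.QuantumFields.YangMills.Theses.BalabanLadder.NT := by
  intro G _ _ _ _ hG
  letI : MeasurableSpace G := borel G
  haveI : BorelSpace G := ⟨rfl⟩
  obtain ⟨r, a, Rs, θ, ha, ha0, hθ, hgap, hunb, hE1, hE2, hE3⟩ := h G hG
  exact ⟨r, a, ha, ha0, lowerBounds_of_geometricPackage G r a ha ha0 Rs θ hθ hgap hunb hE1 hE2 hE3⟩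

end Summit.QuantumFields.YangMills.Cruxes.NT.WeakPackage

end
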